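import Literature.RepresentationTheory.Kovacevic2021.SU21CasimirCentral
import Literature.RepresentationTheory.Kovacevic2021.SU21RelativeCochainsDegreeOne
import Literature.RepresentationTheory.BorelWallach2000.RelativeCohomologyCasimirCriterion
import HarnessLib

/-!
# Kovačević's `SU(2,1)`-modules: a non-zero Casimir scalar kills all `(𝔤, 𝔨)`-cohomology
# (Borel–Wallach II Prop. 3.1 (a) / Cor. 3.3 on the constructed modules); the non-cohomological rays

Topic `RepresentationTheory/Kovacevic2021`; namespace `Literature.RepresentationTheory.Kovacevic2021`.
One definition with body (`glTraceForm`, the trace form of `𝔤𝔩ₙ(𝕜)`) and theorems; no named fact.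

This is the junction of two tree results:
* Borel–Wallach II Prop. 3.1 (a), PROVED abstractly on the tree's relative Chevalley–Eilenberg complex
  (`Literature.RepresentationTheory.BorelWallach2000.subsingleton_relCohomology_of_casimirOp_eq_smul`,
  `RelativeCohomologyCasimirCriterion`): if `σ` is equivariant (`hσ`), the tensor `∑_s y_s ⊗ y'_s` is
  `𝔤`-invariant (`hT`) and the Casimir-type operator `N = ∑_s σ(y_s) ρ(y'_s)` acts by an invertible scalar,
  then `H^q(𝔤, 𝔨; M) = 0` for all `q` ("a cocycle `η` is the coboundary `(r−s)⁻¹ d∂η`"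
  [BorelWallach2000, II 3.1]);
* the Casimir of a `K`-type datum `𝒟 : SU21Datum` [Kovacevic2021, §3]:
  `SU21Datum.casimir = ∑_{i,j} ρ(E_{ij}) ρ(E_{ji})` IS that operator for `σ = ρ` and the canonical tensor
  `∑_{(i,j)} E_{ij} ⊗ E_{ji}` of the trace form (`SU21Datum.casimir_eq_casimirOp`, `SU21CasimirCentral`), and is a
  scalar in closed form on the ray data (`casimir_rayNE_eq_smul`: `C = (e² − 9)/6` on `rayNE e n₀`).

What is proved here:
* §1 (any field `𝕜`, any finite index type `ι`): the **trace form** `B(X, Y) = tr(XY)` on `𝔤𝔩(ι, 𝕜)`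
  (`glTraceForm`) is symmetric, invariant and non-degenerate, the dual basis of the matrix units is the
  transposed family `E_{ab}^∨ = E_{ba}` (`dualBasis_glTraceForm_stdBasis`), hence **the canonical tensor
  `∑_{(a,b)} E_{ab} ⊗ E_{ba}` is `𝔤`-invariant**: `∑ ([x, E_{ab}] ⊗ E_{ba} + E_{ab} ⊗ [x, E_{ba}]) = 0`
  (`sum_lie_single_tmul_single_add`, from `Literature.Algebra.Lie.sum_lie_basis_tmul_dualBasis_add`
  [Bourbaki LIE I §3.7 Prop. 11]) — the hypothesis `hT` for matrix units;
* §2 **BW II Prop. 3.1 (a) / Cor. 3.3 for `K`-type data**: if `𝒟.casimir = c · 1` with `c ≠ 0` then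
  `H^q(𝔤𝔩₃, 𝔨; V) = 0` for every `q` (`SU21Datum.subsingleton_relCohomology_of_casimir_eq_smul`,
  `finrank_relCohomology_eq_zero_of_casimir_eq_smul`); contrapositively a datum with scalar Casimir and some
  non-zero `H^q` has `c = 0` (`casimir_scalar_eq_zero_of_nontrivial_relCohomology`) — Wigner's lemma /
  [BorelWallach2000, I 5.3, II Cor. 3.3] in the form used by VI 4.11 (1) ("`H^*(V) ≠ 0` forces
  infinitesimal character `ρ`");
* §3 **the non-cohomological rays**: the ray data `rayNE e n₀`, `raySE e n₀` of `SU21ModulesFromKTypes` with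
  `e² ≠ 9` (for `n₀ = 1`: `K`-types `V_{n, ±(3n+e)}`, `n ≥ 1` — Kovačević's `U(0, 2t)`-type modules off the
  two cohomological values `e = ±3` realised by `holDS = rayNE 3 1`, `ladderPlus = rayNE (-3) 2`,
  `antiholDS`, `ladderMinus`) have `H^q(𝔤𝔩₃, 𝔨; V) = 0` in every degree
  (`finrank_relCohomology_rayNE_eq_zero`, `finrank_relCohomology_raySE_eq_zero`).

NOT here: BW II 3.1 (b) (`C = 0 ⇒` all relative cochains closed; the tree's version
`BorelWallach2000.d_eq_zero_of_mem_rel` needs Kuga's positivity data over an ordered ring, i.e. a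
Hermitian structure on `V`, which the `K`-type data do not carry — for the six cohomological modules the
equality `H^q = C^q` is obtained degree by degree in `SU21CohomologyDegreeOne/Two` instead); the
classification of ALL data with `C = 0`.

## References

* A. Borel, N. Wallach (2000), I 5.3, II §2.3–2.5, Prop. 3.1, Cor. 3.3 (pp. 34–37; held chunks
  p0059–p0062); VI Thm 4.11 (1). [BorelWallach2000]
* D. Kovačević, Acta Math. Spalatensia 1 (2021) 105–125, §3 Thm 2, Thm 3, Remark 3, §4 Thm 5. [Kovacevic2021]
* A. W. Knapp, *Lie groups beyond an introduction*, 2nd ed. (2002), §I.8, §V.4 (trace form, Casimir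
  element). [Knapp2002]
* N. Bourbaki, *Lie Groups and Lie Algebras* I, §3.7 Prop. 11 (invariance of the Casimir tensor).
-/

noncomputable section

open scoped TensorProduct
open Module
open Literature.Algebra.Lie Literature.Algebra.Lie.ChevalleyEilenberg

namespace Literature.RepresentationTheory.Kovacevic2021

-- Mathlib idiom (Mathlib/Algebra/Lie/OfAssociative.lean): bracket on `Matrix`/`Module.End` = commutator.
attribute [local instance 100] LieRing.ofAssociativeRing

/-! ## §1 The trace form of `𝔤𝔩(ι, 𝕜)` and the invariance of `∑ E_{ab} ⊗ E_{ba}` -/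

section TraceForm

variable (𝕜 : Type*) [Field 𝕜] (ι : Type*) [Fintype ι]

/-- **The trace form** `B(X, Y) = tr(XY)` on `𝔤𝔩(ι, 𝕜)` (a non-degenerate symmetric invariant bilinear form).
[cite: Knapp2002, §V.4] [cite: BorelWallach2000, II §2.3] -/
def glTraceForm : LinearMap.BilinForm 𝕜 (Matrix ι ι 𝕜) :=
  LinearMap.mk₂ 𝕜 (fun X Y => (X * Y).trace)
    (fun X X' Y => by rw [Matrix.add_mul, Matrix.trace_add])
    (fun c X Y => by rw [Matrix.smul_mul, Matrix.trace_smul, smul_eq_mul])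
    (fun X Y Y' => by rw [Matrix.mul_add, Matrix.trace_add])
    (fun c X Y => by rw [Matrix.mul_smul, Matrix.trace_smul, smul_eq_mul])

/-- `B(X, Y) = tr(XY)`. [cite: Knapp2002, §V.4] -/
@[simp] theorem glTraceForm_apply (X Y : Matrix ι ι 𝕜) : glTraceForm 𝕜 ι X Y = (X * Y).trace := rfl

/-- The trace form is symmetric (`tr(XY) = tr(YX)`). [cite: Knapp2002, §V.4] -/
theorem glTraceForm_isSymm : (glTraceForm 𝕜 ι).IsSymm :=
  ⟨fun X Y => by rw [glTraceForm_apply, glTraceForm_apply, Matrix.trace_mul_comm]⟩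

-- the ring structure of `Matrix ι ι 𝕜` (hence its commutator bracket) needs decidable equality on `ι`
variable [DecidableEq ι]

/-- The trace form is invariant: `tr([X,Y] Z) = -tr(Y [X,Z])`. [cite: Knapp2002, §I.8] -/
theorem glTraceForm_lieInvariant : (glTraceForm 𝕜 ι).lieInvariant (Matrix ι ι 𝕜) := by
  intro X Y Z
  simp only [glTraceForm_apply, Ring.lie_def, Matrix.sub_mul, Matrix.mul_sub, Matrix.trace_sub]
  rw [← Matrix.mul_assoc Y Z X, Matrix.trace_mul_cycle Y Z X, Matrix.mul_assoc X Y Z, Matrix.mul_assoc Y X Z]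
  ring

/-- `tr(X E_{ba}) = X_{ab}`. [cite: Knapp2002, §V.4] -/
theorem glTraceForm_single (X : Matrix ι ι 𝕜) (a b : ι) :
    glTraceForm 𝕜 ι X (Matrix.single b a (1 : 𝕜)) = X a b := by
  rw [glTraceForm_apply, Matrix.trace_mul_single]
  simp

/-- The trace form is non-degenerate (test against the matrix units: `tr(X E_{ba}) = X_{ab}`).
[cite: Knapp2002, §V.4] -/
theorem glTraceForm_nondegenerate : (glTraceForm 𝕜 ι).Nondegenerate := by
  refine ⟨fun X hX => ?_, fun Y hY => ?_⟩
  · ext a b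
    have h := hX (Matrix.single b a (1 : 𝕜))
    rwa [glTraceForm_single] at h
  · ext a b
    have h := hY (Matrix.single b a (1 : 𝕜))
    rw [(glTraceForm_isSymm 𝕜 ι).eq, glTraceForm_single] at h
    exact h

/-- **The dual basis of the matrix units under the trace form is the transposed family**:
`E_{ab}^∨ = E_{ba}`. [cite: Knapp2002, §V.4] -/
theorem dualBasis_glTraceForm_stdBasis :
    ⇑((glTraceForm 𝕜 ι).dualBasis (glTraceForm_nondegenerate 𝕜 ι) (Matrix.stdBasis 𝕜 ι ι)) =
      fun p : ι × ι => Matrix.single p.2 p.1 (1 : 𝕜) := by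
  refine (LinearMap.BilinForm.dualBasis_eq_iff (glTraceForm_nondegenerate 𝕜 ι) (Matrix.stdBasis 𝕜 ι ι)
    (fun q : ι × ι => Matrix.single q.2 q.1 (1 : 𝕜))).2 ?_
  rintro ⟨a, b⟩ ⟨c, d⟩
  rw [Matrix.stdBasis_eq_single, (glTraceForm_isSymm 𝕜 ι).eq, glTraceForm_single]
  simp only [Matrix.single, Matrix.of_apply, Prod.mk.injEq]

/-- `stdBasis (a, b) = E_{ab}`, stated on a variable of the product type [folklore] -/
private theorem stdBasis_apply_pair (p : ι × ι) : Matrix.stdBasis 𝕜 ι ι p = Matrix.single p.1 p.2 (1 : 𝕜) := by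
  obtain ⟨a, b⟩ := p
  exact Matrix.stdBasis_eq_single 𝕜 a b

/-- **The canonical tensor `∑_{(a,b)} E_{ab} ⊗ E_{ba}` of the trace form is `𝔤𝔩(ι, 𝕜)`-invariant**:
`∑_{(a,b)} ([x, E_{ab}] ⊗ E_{ba} + E_{ab} ⊗ [x, E_{ba}]) = 0` — the hypothesis `hT` of the tree's Casimir
homotopy (`ChevalleyEilenberg.d_casimirHomotopy_add`) for matrix units. Bourbaki LIE I §3.7 Prop. 11.
[cite: Knapp2002, §V.4] [cite: BorelWallach2000, II §2.3] -/
theorem sum_lie_single_tmul_single_add (x : Matrix ι ι 𝕜) :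
    ∑ p : ι × ι, (⁅x, Matrix.single p.1 p.2 (1 : 𝕜)⁆ ⊗ₜ[𝕜] Matrix.single p.2 p.1 (1 : 𝕜)
      + Matrix.single p.1 p.2 (1 : 𝕜) ⊗ₜ[𝕜] ⁅x, Matrix.single p.2 p.1 (1 : 𝕜)⁆) =
      (0 : Matrix ι ι 𝕜 ⊗[𝕜] Matrix ι ι 𝕜) := by
  have h := Literature.Algebra.Lie.sum_lie_basis_tmul_dualBasis_add (glTraceForm_nondegenerate 𝕜 ι)
    (glTraceForm_isSymm 𝕜 ι) (glTraceForm_lieInvariant 𝕜 ι) (Matrix.stdBasis 𝕜 ι ι) x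
  simp only [dualBasis_glTraceForm_stdBasis, stdBasis_apply_pair] at h
  exact h

end TraceForm

/-! ## §2 BW II Prop. 3.1 (a) for `K`-type data: a non-zero Casimir scalar kills `H^*(𝔤𝔩₃, 𝔨; V)` -/

namespace SU21Datum

variable (𝒟 : SU21Datum)

/-- **Borel–Wallach II Prop. 3.1 (a) / Cor. 3.3 for a `K`-type datum**: if the Casimir
`C = ∑ ρ(E_{ij}) ρ(E_{ji})` of `V = 𝒟.V` is a NON-ZERO scalar `c`, then `H^q(𝔤𝔩₃, 𝔨; V) = 0` for every `q`
(every relative cocycle `η` is the coboundary `d(c⁻¹ h η)` of the Casimir homotopy `h = ∑ ρ(E_{ij}) i_{E_{ji}}`).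
[cite: BorelWallach2000, II Prop. 3.1 (a), Cor. 3.3 pp. 36–37] -/
theorem subsingleton_relCohomology_of_casimir_eq_smul {c : ℂ} (hc : c ≠ 0)
    (h : 𝒟.casimir = c • (1 : Module.End ℂ 𝒟.V)) (q : ℕ) :
    Subsingleton (relCohomology ℂ gl3 𝒟.V kSub q) := by
  haveI : LieSMulComm ℂ gl3 𝒟.V := ⟨fun a x m => lie_smul a x m⟩
  refine BorelWallach2000.subsingleton_relCohomology_of_casimirOp_eq_smul kSub
    (σ := ((LieModule.toEnd ℂ gl3 𝒟.V : gl3 →ₗ⁅ℂ⁆ Module.End ℂ 𝒟.V) : gl3 →ₗ[ℂ] Module.End ℂ 𝒟.V))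
    (y := fun p : Fin 3 × Fin 3 => E p.1 p.2) (y' := fun p : Fin 3 × Fin 3 => E p.2 p.1)
    (fun x u => ?_) (fun x => sum_lie_single_tmul_single_add ℂ (Fin 3) x) hc.isUnit (fun m => ?_) q
  · rw [LieHom.coe_toLinearMap, LieHom.map_lie]
    exact (Ring.lie_def (LieModule.toEnd ℂ gl3 𝒟.V x) (LieModule.toEnd ℂ gl3 𝒟.V u)).symm
  · rw [← casimir_eq_casimirOp, h, LinearMap.smul_apply, Module.End.one_apply]

/-- **`dim H^q(𝔤𝔩₃, 𝔨; V) = 0` for all `q`** when the Casimir is a non-zero scalar.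
[cite: BorelWallach2000, II Prop. 3.1 (a), Cor. 3.3 pp. 36–37] -/
theorem finrank_relCohomology_eq_zero_of_casimir_eq_smul {c : ℂ} (hc : c ≠ 0)
    (h : 𝒟.casimir = c • (1 : Module.End ℂ 𝒟.V)) (q : ℕ) :
    finrank ℂ (relCohomology ℂ gl3 𝒟.V kSub q) = 0 := by
  haveI := 𝒟.subsingleton_relCohomology_of_casimir_eq_smul hc h q
  exact Module.finrank_zero_of_subsingleton

/-- **Wigner's lemma for `K`-type data with scalar Casimir**: if `C = c · 1` and some `H^q(𝔤𝔩₃, 𝔨; V)` is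
non-zero, then `c = 0` (the infinitesimal character is that of the trivial representation) — the input
of VI 4.11 (1). [cite: BorelWallach2000, I 5.3 (ii), II Cor. 3.3, VI Thm 4.11 (1)] -/
theorem casimir_scalar_eq_zero_of_nontrivial_relCohomology {c : ℂ}
    (h : 𝒟.casimir = c • (1 : Module.End ℂ 𝒟.V)) {q : ℕ}
    (hq : Nontrivial (relCohomology ℂ gl3 𝒟.V kSub q)) : c = 0 := by
  by_contra hc
  haveI := 𝒟.subsingleton_relCohomology_of_casimir_eq_smul hc h q
  exact false_of_nontrivial_of_subsingleton (relCohomology ℂ gl3 𝒟.V kSub q)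

/-- The same with the cohomology measured by its dimension: `C = c · 1` and `dim H^q ≠ 0` force `c = 0`.
[cite: BorelWallach2000, I 5.3 (ii), II Cor. 3.3] -/
theorem casimir_scalar_eq_zero_of_finrank_relCohomology_ne_zero {c : ℂ}
    (h : 𝒟.casimir = c • (1 : Module.End ℂ 𝒟.V)) {q : ℕ}
    (hq : finrank ℂ (relCohomology ℂ gl3 𝒟.V kSub q) ≠ 0) : c = 0 := by
  by_contra hc
  exact hq (𝒟.finrank_relCohomology_eq_zero_of_casimir_eq_smul hc h q)

/-! ## §3 The non-cohomological rays: `rayNE e n₀`, `raySE e n₀` with `e² ≠ 9` -/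

/-- the ray scalar `(e² − 9)/6` is non-zero off `e² = 9` [folklore] -/
private theorem ray_scalar_ne_zero {e : ℤ} (he : e ^ 2 ≠ 9) : ((e : ℂ) ^ 2 - 9) / 6 ≠ 0 := by
  refine div_ne_zero (sub_ne_zero.2 fun h9 => he ?_) (by norm_num)
  exact_mod_cast h9

/-- **The north-east rays off `e² = 9` are not cohomological**: for the datum `rayNE e n₀` (`K`-types
`V_{n, 3n+e}`, `n ≥ n₀`; for `n₀ = 1` Kovačević's `U(0, 2t)`, `2t = e + 3`) with `e² ≠ 9` the Casimir is the
non-zero scalar `(e² − 9)/6`, so `H^q(𝔤𝔩₃, 𝔨; V) = 0` for every `q` — in contrast with `e = 3`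
(`holDS = rayNE 3 1 = D₂`, `H² = ℂ`) and `e = -3` (`ladderPlus = rayNE (-3) 2 = J_{1,0}`, `H¹ = H³ = ℂ`).
[cite: BorelWallach2000, II Cor. 3.3 p. 37, VI Thm 4.11 (1)] [cite: Kovacevic2021, §4 Thm 5] -/
theorem finrank_relCohomology_rayNE_eq_zero (e n₀ : ℤ) (h₀ : 1 ≤ n₀)
    (h : 2 * n₀ ^ 2 + (e - 3) * n₀ + (1 - e) = 0) (he : e ^ 2 ≠ 9) (q : ℕ) :
    finrank ℂ (relCohomology ℂ gl3 (rayNE e n₀ h₀ h).V kSub q) = 0 :=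
  (rayNE e n₀ h₀ h).finrank_relCohomology_eq_zero_of_casimir_eq_smul (ray_scalar_ne_zero he)
    (casimir_rayNE_eq_smul e n₀ h₀ h) q

/-- **The south-east rays off `e² = 9` are not cohomological**: `H^q(𝔤𝔩₃, 𝔨; V) = 0` for `raySE e n₀`,
`e² ≠ 9`, every `q` (`e = 3`: `antiholDS = D₀`; `e = -3`: `ladderMinus = J_{0,1}` are the cohomological ones).
[cite: BorelWallach2000, II Cor. 3.3 p. 37, VI Thm 4.11 (1)] [cite: Kovacevic2021, §4 Thm 5] -/
theorem finrank_relCohomology_raySE_eq_zero (e n₀ : ℤ) (h₀ : 1 ≤ n₀)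
    (h : 2 * n₀ ^ 2 + (e - 3) * n₀ + (1 - e) = 0) (he : e ^ 2 ≠ 9) (q : ℕ) :
    finrank ℂ (relCohomology ℂ gl3 (raySE e n₀ h₀ h).V kSub q) = 0 :=
  (raySE e n₀ h₀ h).finrank_relCohomology_eq_zero_of_casimir_eq_smul (ray_scalar_ne_zero he)
    (casimir_raySE_eq_smul e n₀ h₀ h) q

/-- The cohomological dichotomy on the north-east rays: `H^*(𝔤𝔩₃, 𝔨; rayNE e n₀) ≠ 0` in some degree forces
`e² = 9`, i.e. `e = 3` or `e = -3`. [cite: BorelWallach2000, II Cor. 3.3, VI Thm 4.11 (1)] -/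
theorem sq_eq_nine_of_finrank_relCohomology_rayNE_ne_zero (e n₀ : ℤ) (h₀ : 1 ≤ n₀)
    (h : 2 * n₀ ^ 2 + (e - 3) * n₀ + (1 - e) = 0) {q : ℕ}
    (hq : finrank ℂ (relCohomology ℂ gl3 (rayNE e n₀ h₀ h).V kSub q) ≠ 0) : e = 3 ∨ e = -3 := by
  have he : e ^ 2 = 9 := by
    by_contra he
    exact hq (finrank_relCohomology_rayNE_eq_zero e n₀ h₀ h he q)
  have h3 : (e - 3) * (e + 3) = 0 := by linear_combination he
  rcases mul_eq_zero.1 h3 with h1 | h1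
  · left; omega
  · right; omega

end SU21Datum

end Literature.RepresentationTheory.Kovacevic2021
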